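import Summits.NavierStokesRegularity.FluidComputer.PalinstrophyClock
import HarnessLib

/-!
# Fluid computer — support: Cauchy–Schwarz tools on sequences of levels for the `Ḣ^{3/2}` Riccati summation

HONEST FRAMING (cell `pub-fluidc`, verbatim): *low prior, high value-of-information experiment on Tao's
machine paradigm; NOT a claim that NS blows up.* Support file of `RiccatiSummation` (pure bookkeeping on nonnegative
sequences indexed by the levels; no fluid content):

* `tsum_shift_le_sqrt` — `∑_{n≥0} 2^{−cn} x_{q−n} ≤ (∑_n (2^{−c})^n)^{1/2} (∑_l x_l²)^{1/2}` (`c ≥ 0`);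
  (the shifted Cauchy–Schwarz `∑_j z_j x_{j+m} ≤ (∑ z²)^{1/2} (∑ x²)^{1/2}` is the tree's
  `Literature.Analysis.FunctionSpaces.tsum_mul_shift_le`, `DyadicSums.lean`);
* `paraT_weighted_le` — with `s_l ≤ C_B 2^{3l/2} a_l`: `paraT (2^· s) l ≤ 2 C_B 2^{l−3} (∑_j 8^j a_j²)^{1/2}` (the coarse
  strain below a level is controlled by the `Ḃ^{3/2}_{2,2}` row);
* `tsum_tsum_reindex` — `∑_j ∑_{n≥0} F(j, j−4+n) = ∑_l ∑_{n≥0} F(l+4−n, l)`.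

0 sorry; no definitions, no named facts.

## References

* A. Cheskidov, K. Zaya, J. Math. Phys. 57 (2016) 023101 = arXiv:1503.01784, Thm. 2.2. [CheskidovZaya2016]
-/

noncomputable section

open MeasureTheory Set Function Filter Topology Metric
open scoped ENNReal NNReal
open Literature.Analysis.FluidPDE Literature.Analysis.FunctionSpaces

namespace Summit.NavierStokesRegularity.FluidComputer.RiccatiSummationTools

/-! ## Two Cauchy–Schwarz tools on sequences of levels -/

/-- **Cauchy–Schwarz over a shifted half-line of levels**: for `x : ℤ → [0, ∞]`, `q ∈ ℤ` and `c > 0`,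
`∑_{n≥0} 2^{−cn} x_{q−n} ≤ (∑_n (2^{−c})^n)^{1/2} (∑_{l∈ℤ} x_l²)^{1/2}` (Hölder on the counting measure; the shifted
half-line is a sub-family of `ℤ`). [folklore] -/
theorem tsum_shift_le_sqrt (x : ℤ → ℝ≥0∞) (q : ℤ) {c : ℝ} (hc : 0 ≤ c) :
    ∑' n : ℕ, (2 : ℝ≥0∞) ^ (-c * (n : ℝ)) * x (q - n) ≤
      (∑' n : ℕ, ((2 : ℝ≥0∞) ^ (-c)) ^ n) ^ (1 / 2 : ℝ) * (∑' l : ℤ, x l ^ 2) ^ (1 / 2 : ℝ) := by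
  set f : ℕ → ℝ≥0∞ := fun n => (2 : ℝ≥0∞) ^ (-c / 2 * (n : ℝ)) with hf
  set g : ℕ → ℝ≥0∞ := fun n => (2 : ℝ≥0∞) ^ (-c / 2 * (n : ℝ)) * x (q - n) with hg
  have h2 : (2 : ℝ≥0∞) ≠ 0 := two_ne_zero
  have h2' : (2 : ℝ≥0∞) ≠ ⊤ := ENNReal.ofNat_ne_top
  have hfg : ∀ n, f n * g n = (2 : ℝ≥0∞) ^ (-c * (n : ℝ)) * x (q - n) := by
    intro n
    simp only [hf, hg]
    rw [← mul_assoc, ← ENNReal.rpow_add _ _ h2 h2']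
    congr 2
    ring
  have hH := ENNReal.lintegral_mul_le_Lp_mul_Lq (Measure.count : Measure ℕ) Real.HolderConjugate.two_two
    (measurable_from_nat (f := f)).aemeasurable (measurable_from_nat (f := g)).aemeasurable
  rw [lintegral_count, lintegral_count, lintegral_count] at hH
  simp only [Pi.mul_apply] at hH
  have hf2 : ∑' n : ℕ, f n ^ (2 : ℝ) = ∑' n : ℕ, ((2 : ℝ≥0∞) ^ (-c)) ^ n := by
    refine tsum_congr fun n => ?_
    simp only [hf]
    rw [← ENNReal.rpow_mul, ← ENNReal.rpow_natCast, ← ENNReal.rpow_mul]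
    congr 1
    ring
  have hg2 : ∑' n : ℕ, g n ^ (2 : ℝ) ≤ ∑' l : ℤ, x l ^ 2 := by
    calc ∑' n : ℕ, g n ^ (2 : ℝ) ≤ ∑' n : ℕ, x (q - n) ^ 2 := by
          refine ENNReal.tsum_le_tsum fun n => ?_
          simp only [hg]
          rw [ENNReal.mul_rpow_of_nonneg _ _ (by norm_num : (0 : ℝ) ≤ 2), ENNReal.rpow_two (x (q - n))]
          refine mul_le_of_le_one_left bot_le ?_
          rw [← ENNReal.rpow_mul]
          have hexp : -c / 2 * (n : ℝ) * 2 ≤ 0 := by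
            have hn : (0 : ℝ) ≤ n := Nat.cast_nonneg n
            nlinarith
          calc (2 : ℝ≥0∞) ^ (-c / 2 * (n : ℝ) * 2) ≤ (2 : ℝ≥0∞) ^ (0 : ℝ) :=
                ENNReal.rpow_le_rpow_of_exponent_le (by norm_num) hexp
            _ = 1 := ENNReal.rpow_zero
      _ ≤ ∑' l : ℤ, x l ^ 2 :=
          ENNReal.tsum_comp_le_tsum_of_injective (f := fun n : ℕ => q - (n : ℤ))
            (fun a b hab => by simpa using hab) (fun l => x l ^ 2)
  calc ∑' n : ℕ, (2 : ℝ≥0∞) ^ (-c * (n : ℝ)) * x (q - n)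
      = ∑' n : ℕ, f n * g n := tsum_congr fun n => (hfg n).symm
    _ ≤ (∑' n : ℕ, f n ^ (2 : ℝ)) ^ (1 / (2 : ℝ)) * (∑' n : ℕ, g n ^ (2 : ℝ)) ^ (1 / (2 : ℝ)) := hH
    _ ≤ _ := by
        rw [hf2]
        exact mul_le_mul' le_rfl (ENNReal.rpow_le_rpow hg2 (by norm_num))

/-! ## The coarse strain below a level; reindexing -/

variable (a s : ℤ → ℝ≥0∞) (CB : ℝ≥0∞)

/-- **Bound on the coarse strain** (`paraT` of the weighted sups): with `s_l ≤ C_B 2^{3l/2} a_l`, for every `l ∈ ℤ`,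
`∑_{n≥0} 2^{l−3−n} s_{l−3−n} ≤ C_B · 2 · 2^{l−3} · (∑_j 8^j a_j²)^{1/2}` (Bernstein and `tsum_shift_le_sqrt` with `c = 1`;
`(∑_n 2^{−n})^{1/2} = √2 ≤ 2`). [folklore] -/
theorem paraT_weighted_le (hB : ∀ l : ℤ, s l ≤ CB * (2 : ℝ≥0∞) ^ ((3 / 2 : ℝ) * (l : ℝ)) * a l) (l : ℤ) :
    paraT (fun l' => (2 : ℝ≥0∞) ^ l' * s l') l ≤
      CB * (2 * ((2 : ℝ≥0∞) ^ ((l : ℝ) - 3) *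
        (∑' j : ℤ, (2 : ℝ≥0∞) ^ ((3 : ℝ) * (j : ℝ)) * a j ^ 2) ^ (1 / 2 : ℝ))) := by
  have h2 : (2 : ℝ≥0∞) ≠ 0 := two_ne_zero
  have h2' : (2 : ℝ≥0∞) ≠ ⊤ := ENNReal.ofNat_ne_top
  set q : ℤ := l - 3 with hq
  set x : ℤ → ℝ≥0∞ := fun k => (2 : ℝ≥0∞) ^ ((3 / 2 : ℝ) * (k : ℝ)) * a k with hx
  -- termwise: `2^{q−n} s_{q−n} ≤ CB · 2^q · 2^{−n} · x_{q−n}`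
  have hterm : ∀ n : ℕ, (2 : ℝ≥0∞) ^ (l - 3 - (n : ℤ)) * s (l - 3 - n) ≤
      CB * (2 : ℝ≥0∞) ^ ((l : ℝ) - 3) * ((2 : ℝ≥0∞) ^ (-(1 : ℝ) * (n : ℝ)) * x (q - n)) := by
    intro n
    have e : l - 3 - (n : ℤ) = q - n := by rw [hq]
    rw [e]
    calc (2 : ℝ≥0∞) ^ (q - (n : ℤ)) * s (q - n)
        ≤ (2 : ℝ≥0∞) ^ (q - (n : ℤ)) * (CB * (2 : ℝ≥0∞) ^ ((3 / 2 : ℝ) * ((q - n : ℤ) : ℝ)) * a (q - n)) :=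
          mul_le_mul' le_rfl (hB _)
      _ = CB * (2 : ℝ≥0∞) ^ ((l : ℝ) - 3) * ((2 : ℝ≥0∞) ^ (-(1 : ℝ) * (n : ℝ)) * x (q - n)) := by
          simp only [hx]
          rw [← ENNReal.rpow_intCast]
          have : ((q - (n : ℤ) : ℤ) : ℝ) = (l : ℝ) - 3 - n := by rw [hq]; push_cast; ring
          rw [this]
          have e2 : (2 : ℝ≥0∞) ^ ((l : ℝ) - 3 - n) = (2 : ℝ≥0∞) ^ ((l : ℝ) - 3) * (2 : ℝ≥0∞) ^ (-(1 : ℝ) * (n : ℝ)) := by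
            rw [← ENNReal.rpow_add _ _ h2 h2']; congr 1; ring
          rw [e2]
          ring
  calc paraT (fun l' => (2 : ℝ≥0∞) ^ l' * s l') l
      = ∑' n : ℕ, (2 : ℝ≥0∞) ^ (l - 3 - (n : ℤ)) * s (l - 3 - n) := rfl
    _ ≤ ∑' n : ℕ, CB * (2 : ℝ≥0∞) ^ ((l : ℝ) - 3) * ((2 : ℝ≥0∞) ^ (-(1 : ℝ) * (n : ℝ)) * x (q - n)) :=
        ENNReal.tsum_le_tsum hterm
    _ = CB * (2 : ℝ≥0∞) ^ ((l : ℝ) - 3) * ∑' n : ℕ, (2 : ℝ≥0∞) ^ (-(1 : ℝ) * (n : ℝ)) * x (q - n) :=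
        ENNReal.tsum_mul_left
    _ ≤ CB * (2 : ℝ≥0∞) ^ ((l : ℝ) - 3) *
          ((∑' n : ℕ, ((2 : ℝ≥0∞) ^ (-(1 : ℝ))) ^ n) ^ (1 / 2 : ℝ) * (∑' k : ℤ, x k ^ 2) ^ (1 / 2 : ℝ)) :=
        mul_le_mul' le_rfl (tsum_shift_le_sqrt x q zero_le_one)
    _ ≤ CB * (2 * ((2 : ℝ≥0∞) ^ ((l : ℝ) - 3) *
          (∑' j : ℤ, (2 : ℝ≥0∞) ^ ((3 : ℝ) * (j : ℝ)) * a j ^ 2) ^ (1 / 2 : ℝ))) := by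
        -- `∑ 2^{−n} = 2`, `2^{1/2} ≤ 2`, `∑ x² = ∑ 8^j a_j²`
        have hG : (∑' n : ℕ, ((2 : ℝ≥0∞) ^ (-(1 : ℝ))) ^ n) = 2 := by
          rw [ENNReal.rpow_neg_one, ENNReal.tsum_geometric, ENNReal.one_sub_inv_two, inv_inv]
        have hG' : ((2 : ℝ≥0∞)) ^ (1 / 2 : ℝ) ≤ 2 := by
          calc (2 : ℝ≥0∞) ^ (1 / 2 : ℝ) ≤ (2 : ℝ≥0∞) ^ (1 : ℝ) :=
                ENNReal.rpow_le_rpow_of_exponent_le (by norm_num) (by norm_num)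
            _ = 2 := ENNReal.rpow_one _
        have hxy : ∑' k : ℤ, x k ^ 2 = ∑' j : ℤ, (2 : ℝ≥0∞) ^ ((3 : ℝ) * (j : ℝ)) * a j ^ 2 := by
          refine tsum_congr fun k => ?_
          simp only [hx]
          rw [mul_pow, ← ENNReal.rpow_natCast ((2 : ℝ≥0∞) ^ _) 2, ← ENNReal.rpow_mul]
          congr 2
          push_cast
          ring
        rw [hG, hxy]
        calc CB * (2 : ℝ≥0∞) ^ ((l : ℝ) - 3) * ((2 : ℝ≥0∞) ^ (1 / 2 : ℝ) *
              (∑' j : ℤ, (2 : ℝ≥0∞) ^ ((3 : ℝ) * (j : ℝ)) * a j ^ 2) ^ (1 / 2 : ℝ))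
            ≤ CB * (2 : ℝ≥0∞) ^ ((l : ℝ) - 3) * (2 * (∑' j : ℤ, (2 : ℝ≥0∞) ^ ((3 : ℝ) * (j : ℝ)) * a j ^ 2) ^ (1 / 2 : ℝ)) := by
              gcongr
          _ = _ := by ring

/-- **Reindexing a level/offset double sum**: `∑_j ∑_{n≥0} F(j, j−4+n) = ∑_l ∑_{n≥0} F(l+4−n, l)` in `[0, ∞]`
(the bijection `(j, n) ↦ (j − 4 + n, n)` of `ℤ × ℕ`). [folklore] -/
theorem tsum_tsum_reindex (F : ℤ → ℤ → ℝ≥0∞) :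
    ∑' j : ℤ, ∑' n : ℕ, F j (j - 4 + n) = ∑' l : ℤ, ∑' n : ℕ, F (l + 4 - n) l := by
  set e : ℤ × ℕ ≃ ℤ × ℕ :=
    { toFun := fun p => (p.1 - 4 + p.2, p.2)
      invFun := fun p => (p.1 + 4 - p.2, p.2)
      left_inv := fun p => by
        rcases p with ⟨j, n⟩
        simp only [Prod.mk.injEq, and_true]
        ring
      right_inv := fun p => by
        rcases p with ⟨l, n⟩
        simp only [Prod.mk.injEq, and_true]
        ring }
  rw [← ENNReal.tsum_prod, ← ENNReal.tsum_prod]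
  rw [← e.symm.tsum_eq]
  refine tsum_congr fun p => ?_
  simp only [e, Equiv.coe_fn_symm_mk]
  congr 1
  ring

end Summit.NavierStokesRegularity.FluidComputer.RiccatiSummationTools

end
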